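import Mathlib
import HarnessLib
import Literature.Analysis.Complex.BoundaryUniqueness
import Summits.Ventures.LatticeQCDFlow.Exactness.U1LeapfrogHMC
import Summits.Ventures.LatticeQCDFlow.Exactness.LeapfrogHMCDoeblin

/-!
# The `n`-step leapfrog trajectory on `U(1)` lattice gauge fields: free flight plus a bounded, Lipschitz-small deviation

HONEST FRAMING: exact (Metropolis-corrected) sampling algorithms for lattice gauge theory;
figures of merit are autocorrelation/cost numbers at stated couplings and volumes; no
continuum-physics claim.

Venture `LatticeQCDFlow` (cell pub-lqcd), topic `Exactness`, FANOUT row 14 (`eng-flowhmc`, engine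
`latflow.fthmc`, family B, `U(1)` rung; equally row 9's `latflow.core` `U(1)` HMC at
`trajectory(τ, nstep = n)`).  NEW WORK of the cell over the tree's `SplittingIntegrator.lean`
(`kick`, `drift`, `mulDrift`), `SplittingWords.lean` (`palindromicWord`), `U1LeapfrogHMC.lean`
(`u1ExpDrift`) and `LeapfrogHMCDoeblin.lean` (`palindromicWord_kick_drift`); nothing is cited as a
fact; no number.  The one published inequality used, `|e^{iθ} − e^{iθ₀}| ≤ |θ − θ₀|`, is imported
by name (`Complex.norm_exp_mul_I_sub_exp_mul_I_le`, literature support file `BoundaryUniqueness`).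

Row 9 typed single-step (`nstep = 1`) leapfrog HMC / FT-HMC as uniformly ergodic and wrote, for
`nstep ≥ 2`: "two or more drifts compose and no hypothesis-free minorant is offered — fixed-length
trajectories can be non-ergodic (Mackenzie 1989)".  On the ABELIAN rung the drifts DO compose into
one: this file unfolds the `n`-fold P-first leapfrog word `(K(g) D(e_ε) K(g))^n` from `(u, p)`
(configuration `u : ι → U(1)`, momentum `p : ι → ℝ`, ANY momentum increment `g` with `‖g‖ ≤ b`
that is `L`-Lipschitz for the sup/chordal metrics) as

  `W^k (u, p) = (e_ε(k • p + α_k(p)) · u, p + β_k(p))`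

— FREE FLIGHT `k • p` plus a deviation — with (`η := L|ε|`, and for `k ≤ n` under the
SHORT-TRAJECTORY CONDITION `η n² ≤ 1`):

* `‖α_k(p)‖ ≤ k² b`, `‖β_k(p)‖ ≤ 2 k b` (bounded force ⇒ bounded deviation);
* `‖α_k(p) − α_k(p')‖ ≤ (2/3) η (k³ − k) ‖p − p'‖`, `‖β_k(p) − β_k(p')‖ ≤ 2 η k² ‖p − p'‖`
  (Lipschitz force ⇒ the deviation is Lipschitz-SMALL: `(2/3) η (n³ − n) ≤ (2/3) n < n`).

Lemmas: `u1ExpDrift_zero'`, `u1ExpDrift_add'` (the drift factors form a one-parameter group),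
`dist_u1ExpDrift_mul_le` (`dist (e_ε(a)·u, e_ε(a')·u) ≤ |ε| ‖a − a'‖`), `u1Kdk_apply` (one step),
**`u1Leapfrog_pow_decomposition`** (the induction), and the two readings the Doeblin argument of
`U1MultiStepLeapfrogHMCErgodic.lean` consumes: **`exists_u1Leapfrog_pow_fst`** (the proposed
configuration is ONE exponential drift `e_ε(Ψ_u(p)) · u` of `Ψ_u = n • id + G_u`, `‖G_u‖ ≤ n² b`,
`G_u` `(2/3)n`-Lipschitz) and **`norm_u1Leapfrog_pow_snd_sub_le`** (`‖p_n − p‖ ≤ 2 n b` for ANY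
bounded `g`, the energy window).  NOT here: kernels, measures, `SU(2)` (drifts do not compose
there), OMF words.
-/

noncomputable section

namespace Summit.Ventures.LatticeQCDFlow.Exactness

open Set Metric
open scoped NNReal

variable {ι : Type*}

/-! ## §1 The drift factors form a one-parameter group -/

/-- `e_ε(0) = 1`. -/
theorem u1ExpDrift_zero' (ε : ℝ) : u1ExpDrift (ι := ι) ε 0 = 1 := by
  funext l
  simp only [u1ExpDrift_apply, Pi.zero_apply, mul_zero, Circle.exp_zero, Pi.one_apply]

/-- `e_ε(a + a') = e_ε(a) · e_ε(a')` (link-wise `U(1)` is abelian). -/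
theorem u1ExpDrift_add' (ε : ℝ) (a a' : ι → ℝ) :
    u1ExpDrift ε (a + a') = u1ExpDrift ε a * u1ExpDrift ε a' := by
  funext l
  simp only [u1ExpDrift_apply, Pi.add_apply, Pi.mul_apply, mul_add, Circle.exp_add]

/-! ## §2 One P-first leapfrog step, unfolded -/

section Step

variable (ε : ℝ) (g : (ι → Circle) → ι → ℝ)

/-- **One step `K(g) D(e_ε) K(g)` from `(u, q)`**: with the kicked momentum `q' = q + g u` the new
state is `(e_ε(q') · u, q' + g (e_ε(q') · u))`. -/
theorem u1Kdk_apply (z : (ι → Circle) × (ι → ℝ)) :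
    palindromicWord [kick g] (drift (mulDrift (u1ExpDrift ε))) z =
      (u1ExpDrift ε (z.2 + g z.1) * z.1,
        z.2 + g z.1 + g (u1ExpDrift ε (z.2 + g z.1) * z.1)) := by
  rw [palindromicWord_kick_drift]
  rfl

/-- `W^{k+1} z = W (W^k z)`. -/
theorem u1Kdk_pow_succ_apply (k : ℕ) (z : (ι → Circle) × (ι → ℝ)) :
    (palindromicWord [kick g] (drift (mulDrift (u1ExpDrift ε))) ^ (k + 1)) z =
      palindromicWord [kick g] (drift (mulDrift (u1ExpDrift ε)))
        ((palindromicWord [kick g] (drift (mulDrift (u1ExpDrift ε))) ^ k) z) := by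
  rw [pow_succ', Equiv.Perm.mul_apply]

end Step

/-! ## §3 The `n`-step trajectory: free flight plus a bounded, Lipschitz-small deviation -/

section Trajectory

variable [Fintype ι]

/-- **The drifted configuration is `|ε|`-Lipschitz in the momentum** (chordal sup metric on
`ι → U(1)`, sup norm on `ι → ℝ`): `dist (e_ε(a)·u, e_ε(a')·u) ≤ |ε| ‖a − a'‖`. -/
theorem dist_u1ExpDrift_mul_le (ε : ℝ) (a a' : ι → ℝ) (u : ι → Circle) :
    dist (u1ExpDrift ε a * u) (u1ExpDrift ε a' * u) ≤ |ε| * ‖a - a'‖ := by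
  refine (dist_pi_le_iff (mul_nonneg (abs_nonneg ε) (norm_nonneg _))).2 fun l => ?_
  simp only [Pi.mul_apply, u1ExpDrift_apply]
  change dist ((Circle.exp (ε * a l) * u l : Circle) : ℂ) ((Circle.exp (ε * a' l) * u l : Circle) : ℂ) ≤ _
  rw [dist_eq_norm, Circle.coe_mul, Circle.coe_mul, ← sub_mul, norm_mul, Circle.norm_coe, mul_one,
    Circle.coe_exp, Circle.coe_exp]
  calc ‖Complex.exp (((ε * a l : ℝ) : ℂ) * Complex.I) - Complex.exp (((ε * a' l : ℝ) : ℂ) * Complex.I)‖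
      ≤ |ε * a l - ε * a' l| := Complex.norm_exp_mul_I_sub_exp_mul_I_le _ _
    _ = |ε| * ‖(a - a') l‖ := by rw [← mul_sub, abs_mul, Pi.sub_apply, Real.norm_eq_abs]
    _ ≤ |ε| * ‖a - a'‖ := mul_le_mul_of_nonneg_left (norm_le_pi_norm _ l) (abs_nonneg ε)

variable {ε : ℝ} {g : (ι → Circle) → ι → ℝ} {b : ℝ} {L : ℝ≥0}

/-- The force read at a drifted configuration is `η (k + X)`-Lipschitz in the momentum when the
drift argument `k • p + α(p)` has `‖α(p) − α(p')‖ ≤ X ‖p − p'‖` (`η = L|ε|`). -/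
theorem norm_g_drift_sub_le (hL : LipschitzWith L g) (u : ι → Circle) {k X : ℝ}
    {α : (ι → ℝ) → ι → ℝ} (hα : ∀ p p', ‖α p - α p'‖ ≤ X * ‖p - p'‖) (p p' : ι → ℝ) :
    ‖g (u1ExpDrift ε (k • p + α p) * u) - g (u1ExpDrift ε (k • p' + α p') * u)‖ ≤
      (L : ℝ) * |ε| * (|k| + X) * ‖p - p'‖ := by
  have h1 := hL.dist_le_mul (u1ExpDrift ε (k • p + α p) * u) (u1ExpDrift ε (k • p' + α p') * u)
  rw [dist_eq_norm] at h1
  have h2 := dist_u1ExpDrift_mul_le ε (k • p + α p) (k • p' + α p') u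
  have h3 : ‖(k • p + α p) - (k • p' + α p')‖ ≤ (|k| + X) * ‖p - p'‖ := by
    calc ‖(k • p + α p) - (k • p' + α p')‖ = ‖k • (p - p') + (α p - α p')‖ := by
          rw [smul_sub]; congr 1; abel
      _ ≤ ‖k • (p - p')‖ + ‖α p - α p'‖ := norm_add_le _ _
      _ ≤ |k| * ‖p - p'‖ + X * ‖p - p'‖ := by
          rw [norm_smul, Real.norm_eq_abs]; exact add_le_add le_rfl (hα p p')
      _ = (|k| + X) * ‖p - p'‖ := by ring
  calc ‖g (u1ExpDrift ε (k • p + α p) * u) - g (u1ExpDrift ε (k • p' + α p') * u)‖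
      ≤ L * dist (u1ExpDrift ε (k • p + α p) * u) (u1ExpDrift ε (k • p' + α p') * u) := h1
    _ ≤ L * (|ε| * ((|k| + X) * ‖p - p'‖)) :=
        mul_le_mul_of_nonneg_left (h2.trans (mul_le_mul_of_nonneg_left h3 (abs_nonneg ε)))
          (NNReal.coe_nonneg L)
    _ = (L : ℝ) * |ε| * (|k| + X) * ‖p - p'‖ := by ring

/-- **THE `n`-STEP LEAPFROG TRAJECTORY ON `U(1)^ι`, UNFOLDED.**  Momentum increment `g` with
`‖g u‖ ≤ b` and `L`-Lipschitz; `η := L|ε|`; short-trajectory condition `η n² ≤ 1`.  For every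
`k ≤ n` there are deviation maps `α_k, β_k` with, for all momenta `p, p'`:
`W^k (u, p) = (e_ε(k • p + α_k p) · u, p + β_k p)`, `‖α_k p‖ ≤ k² b`, `‖β_k p‖ ≤ 2 k b`,
`‖α_k p − α_k p'‖ ≤ (2/3) η (k³ − k) ‖p − p'‖`, `‖β_k p − β_k p'‖ ≤ 2 η k² ‖p − p'‖`. -/
theorem u1Leapfrog_pow_decomposition (hb : ∀ u, ‖g u‖ ≤ b) (hL : LipschitzWith L g)
    (u : ι → Circle) {n : ℕ} (hn : (L : ℝ) * |ε| * (n : ℝ) ^ 2 ≤ 1) :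
    ∀ k : ℕ, k ≤ n → ∃ α β : (ι → ℝ) → ι → ℝ,
      (∀ p, (palindromicWord [kick g] (drift (mulDrift (u1ExpDrift ε))) ^ k) (u, p) =
        (u1ExpDrift ε ((k : ℝ) • p + α p) * u, p + β p)) ∧
      (∀ p, ‖α p‖ ≤ (k : ℝ) ^ 2 * b) ∧ (∀ p, ‖β p‖ ≤ 2 * k * b) ∧
      (∀ p p', ‖α p - α p'‖ ≤ 2 / 3 * ((L : ℝ) * |ε|) * ((k : ℝ) ^ 3 - k) * ‖p - p'‖) ∧
      (∀ p p', ‖β p - β p'‖ ≤ 2 * ((L : ℝ) * |ε|) * (k : ℝ) ^ 2 * ‖p - p'‖) := by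
  set η : ℝ := (L : ℝ) * |ε| with hη
  have hη0 : 0 ≤ η := mul_nonneg (NNReal.coe_nonneg L) (abs_nonneg ε)
  have hb0 : 0 ≤ b := (norm_nonneg _).trans (hb fun _ => 1)
  intro k
  induction k with
  | zero =>
    intro _
    refine ⟨fun _ => 0, fun _ => 0, fun p => ?_, fun p => ?_, fun p => ?_, fun p p' => ?_,
      fun p p' => ?_⟩
    · rw [pow_zero, Equiv.Perm.one_apply, Nat.cast_zero, zero_smul, add_zero, u1ExpDrift_zero',
        one_mul, add_zero]
    · simp
    · simp
    · simp
    · simp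
  | succ k ih =>
    intro hk
    obtain ⟨α, β, hW, hαb, hβb, hαL, hβL⟩ := ih (Nat.le_of_succ_le hk)
    -- the a-priori bounds `η k² ≤ 1`, `η (k+1)² ≤ 1`
    have hk1 : (k : ℝ) + 1 ≤ n := by exact_mod_cast hk
    have hkk : (0 : ℝ) ≤ k := Nat.cast_nonneg k
    have hηk1 : η * ((k : ℝ) + 1) ^ 2 ≤ 1 :=
      (mul_le_mul_of_nonneg_left (pow_le_pow_left₀ (by positivity) hk1 2) hη0).trans hn
    have hηk : η * (k : ℝ) ^ 2 ≤ 1 :=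
      (mul_le_mul_of_nonneg_left (pow_le_pow_left₀ hkk (by linarith) 2) hη0).trans hηk1
    -- the Lipschitz constant of `α_k` is at most `k`
    have hXk : 2 / 3 * η * ((k : ℝ) ^ 3 - k) ≤ k := by nlinarith
    -- the new deviation maps
    set U : (ι → ℝ) → ι → Circle := fun p => u1ExpDrift ε ((k : ℝ) • p + α p) * u with hU
    set α' : (ι → ℝ) → ι → ℝ := fun p => α p + β p + g (U p) with hα'
    set U' : (ι → ℝ) → ι → Circle := fun p => u1ExpDrift ε (((k : ℝ) + 1) • p + α' p) * u with hU'
    set β' : (ι → ℝ) → ι → ℝ := fun p => β p + g (U p) + g (U' p) with hβ'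
    -- the accumulated drift argument after the new step
    have harg : ∀ p, p + β p + g (U p) + ((k : ℝ) • p + α p) = ((k : ℝ) + 1) • p + α' p := by
      intro p
      funext l
      simp only [hα', Pi.add_apply, Pi.smul_apply, smul_eq_mul]
      ring
    have hU'eq : ∀ p, u1ExpDrift ε (p + β p + g (U p)) * U p = U' p := by
      intro p
      rw [hU', hU]
      dsimp only
      rw [← mul_assoc, ← u1ExpDrift_add', harg]
    -- Lipschitz constants of the two force readings
    have hgU : ∀ p p', ‖g (U p) - g (U p')‖ ≤ 2 * η * k * ‖p - p'‖ := by
      intro p p'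
      refine (norm_g_drift_sub_le hL u hαL p p').trans ?_
      rw [abs_of_nonneg hkk]
      have : (L : ℝ) * |ε| * (k + 2 / 3 * (L * |ε|) * ((k : ℝ) ^ 3 - k)) ≤ 2 * η * k := by
        rw [← hη]; nlinarith
      exact mul_le_mul_of_nonneg_right this (norm_nonneg _)
    have hα'L : ∀ p p', ‖α' p - α' p'‖ ≤
        2 / 3 * η * (((k : ℝ) + 1) ^ 3 - (k + 1)) * ‖p - p'‖ := by
      intro p p'
      rw [hα']
      dsimp only
      calc ‖α p + β p + g (U p) - (α p' + β p' + g (U p'))‖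
          = ‖(α p - α p') + (β p - β p') + (g (U p) - g (U p'))‖ := by congr 1; abel
        _ ≤ ‖α p - α p'‖ + ‖β p - β p'‖ + ‖g (U p) - g (U p')‖ := norm_add₃_le
        _ ≤ 2 / 3 * η * ((k : ℝ) ^ 3 - k) * ‖p - p'‖ + 2 * η * (k : ℝ) ^ 2 * ‖p - p'‖ +
              2 * η * k * ‖p - p'‖ := add_le_add (add_le_add (hαL p p') (hβL p p')) (hgU p p')
        _ = 2 / 3 * η * (((k : ℝ) + 1) ^ 3 - (k + 1)) * ‖p - p'‖ := by ring
    have hXk1 : 2 / 3 * η * (((k : ℝ) + 1) ^ 3 - (k + 1)) ≤ k + 1 := by nlinarith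
    have hgU' : ∀ p p', ‖g (U' p) - g (U' p')‖ ≤ 2 * η * (k + 1) * ‖p - p'‖ := by
      intro p p'
      refine (norm_g_drift_sub_le hL u hα'L p p').trans ?_
      rw [abs_of_nonneg (show (0 : ℝ) ≤ (k : ℝ) + 1 by linarith)]
      have : (L : ℝ) * |ε| * ((k : ℝ) + 1 + 2 / 3 * η * (((k : ℝ) + 1) ^ 3 - (k + 1))) ≤
          2 * η * (k + 1) := by
        rw [← hη]; nlinarith
      exact mul_le_mul_of_nonneg_right this (norm_nonneg _)
    refine ⟨α', β', fun p => ?_, fun p => ?_, fun p => ?_, fun p p' => ?_, fun p p' => ?_⟩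
    · -- the trajectory formula
      rw [u1Kdk_pow_succ_apply, hW p, u1Kdk_apply]
      dsimp only
      rw [hU'eq p, Nat.cast_succ, hβ']
      refine Prod.ext ?_ ?_
      · rfl
      · dsimp only
        abel
    · -- `‖α'‖ ≤ (k+1)² b`
      rw [hα', Nat.cast_succ]
      dsimp only
      calc ‖α p + β p + g (U p)‖ ≤ ‖α p‖ + ‖β p‖ + ‖g (U p)‖ := norm_add₃_le
        _ ≤ (k : ℝ) ^ 2 * b + 2 * k * b + b := add_le_add (add_le_add (hαb p) (hβb p)) (hb _)
        _ = ((k : ℝ) + 1) ^ 2 * b := by ring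
    · -- `‖β'‖ ≤ 2 (k+1) b`
      rw [hβ', Nat.cast_succ]
      dsimp only
      calc ‖β p + g (U p) + g (U' p)‖ ≤ ‖β p‖ + ‖g (U p)‖ + ‖g (U' p)‖ := norm_add₃_le
        _ ≤ 2 * k * b + b + b := add_le_add (add_le_add (hβb p) (hb _)) (hb _)
        _ = 2 * ((k : ℝ) + 1) * b := by ring
    · rw [Nat.cast_succ]
      exact hα'L p p'
    · rw [hβ', Nat.cast_succ]
      dsimp only
      calc ‖β p + g (U p) + g (U' p) - (β p' + g (U p') + g (U' p'))‖
          = ‖(β p - β p') + (g (U p) - g (U p')) + (g (U' p) - g (U' p'))‖ := by congr 1; abel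
        _ ≤ ‖β p - β p'‖ + ‖g (U p) - g (U p')‖ + ‖g (U' p) - g (U' p')‖ := norm_add₃_le
        _ ≤ 2 * η * (k : ℝ) ^ 2 * ‖p - p'‖ + 2 * η * k * ‖p - p'‖ + 2 * η * (k + 1) * ‖p - p'‖ :=
            add_le_add (add_le_add (hβL p p') (hgU p p')) (hgU' p p')
        _ = 2 * η * ((k : ℝ) + 1) ^ 2 * ‖p - p'‖ := by ring

/-- **THE PROPOSED CONFIGURATION OF `n`-STEP LEAPFROG IS ONE EXPONENTIAL DRIFT OF A
LIPSCHITZ-SMALL PERTURBATION OF FREE FLIGHT.**  Under `‖g‖ ≤ b`, `g` `L`-Lipschitz and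
`L|ε| n² ≤ 1`: from every configuration `u` there is `G_u` with `‖G_u p‖ ≤ n² b`, `G_u`
`(2/3)n`-Lipschitz (as `LipschitzWith (2/3·n).toNNReal`), and
`(flip ∘ W^n) (u, p) .1 = e_ε(n • p + G_u p) · u` for every momentum `p`. -/
theorem exists_u1Leapfrog_pow_fst (hb : ∀ u, ‖g u‖ ≤ b) (hL : LipschitzWith L g)
    {n : ℕ} (hn : (L : ℝ) * |ε| * (n : ℝ) ^ 2 ≤ 1) (u : ι → Circle) :
    ∃ G : (ι → ℝ) → ι → ℝ, (∀ p, ‖G p‖ ≤ (n : ℝ) ^ 2 * b) ∧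
      LipschitzWith (Real.toNNReal (2 / 3 * n)) G ∧
      ∀ p, (((flip : Equiv.Perm ((ι → Circle) × (ι → ℝ))) *
          palindromicWord [kick g] (drift (mulDrift (u1ExpDrift ε))) ^ n) (u, p)).1 =
        u1ExpDrift ε ((n : ℝ) • p + G p) * u := by
  obtain ⟨α, β, hW, hαb, -, hαL, -⟩ := u1Leapfrog_pow_decomposition hb hL u hn n le_rfl
  have hη0 : 0 ≤ (L : ℝ) * |ε| := mul_nonneg (NNReal.coe_nonneg L) (abs_nonneg ε)
  have hn0 : (0 : ℝ) ≤ n := Nat.cast_nonneg n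
  have hX : 2 / 3 * ((L : ℝ) * |ε|) * ((n : ℝ) ^ 3 - n) ≤ 2 / 3 * n := by
    have h1 : (L : ℝ) * |ε| * ((n : ℝ) ^ 3 - n) ≤ n := by nlinarith
    nlinarith
  refine ⟨α, hαb, LipschitzWith.of_dist_le_mul fun p p' => ?_, fun p => ?_⟩
  · rw [Real.coe_toNNReal _ (by positivity), dist_eq_norm, dist_eq_norm]
    exact (hαL p p').trans (mul_le_mul_of_nonneg_right hX (norm_nonneg _))
  · rw [Equiv.Perm.mul_apply, hW p, flip_apply]

/-- **The momentum after `n` steps stays within `2 n b` of the initial one** (sup norm), for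
ANY momentum increment with `‖g‖ ≤ b` (no Lipschitz or step-size hypothesis): the energy-window
input of the Doeblin argument. -/
theorem norm_u1Leapfrog_pow_snd_sub_le (hb : ∀ u, ‖g u‖ ≤ b) (u : ι → Circle) (p : ι → ℝ) :
    ∀ n : ℕ, ‖((palindromicWord [kick g] (drift (mulDrift (u1ExpDrift ε))) ^ n) (u, p)).2 - p‖ ≤
      2 * n * b := by
  intro n
  induction n with
  | zero => simp
  | succ k ih =>
    rw [u1Kdk_pow_succ_apply, u1Kdk_apply, Nat.cast_succ]
    set z := (palindromicWord [kick g] (drift (mulDrift (u1ExpDrift ε))) ^ k) (u, p)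
    dsimp only
    calc ‖z.2 + g z.1 + g (u1ExpDrift ε (z.2 + g z.1) * z.1) - p‖
        = ‖(z.2 - p) + g z.1 + g (u1ExpDrift ε (z.2 + g z.1) * z.1)‖ := by congr 1; abel
      _ ≤ ‖z.2 - p‖ + ‖g z.1‖ + ‖g (u1ExpDrift ε (z.2 + g z.1) * z.1)‖ := norm_add₃_le
      _ ≤ 2 * k * b + b + b := add_le_add (add_le_add ih (hb _)) (hb _)
      _ = 2 * ((k : ℝ) + 1) * b := by ring

end Trajectory

end Summit.Ventures.LatticeQCDFlow.Exactness
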